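import Summits.AnomalousDissipation.AnomalousDissipation.Theses.WindLine
import Summits.AnomalousDissipation.AnomalousDissipation.Theorems.WindLineWindySteadyLimitEnergy

/-!
# Route WindLine (AnomalousDissipation) — `WindySteadyLimit`

Settles stmt-AnomalousDissipation-11421 (support item `WindySteadyLimit` of route
`AnomalousDissipation/WindLine`): at a FIXED viscosity `ν > 0` and for a smooth divergence-free
mean-zero force `f` on `T³`, windy Fourier–Galerkin steady states at infinitely many resolutions `N`
(smooth, divergence free, band-limited to `|k| ≤ N` WITH THE MEAN MODE FREE, solving the tested
Galerkin equations `∫ ⟪u,(u·∇)a⟫ + ν⟪u,Δa⟫ + ⟪f,a⟫ = 0` against all smooth divergence-free `a`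
band-limited to `0 < |k| ≤ N`, with `∫ |u|² ≤ E` and `ν ‖∇u‖² ≥ ε`) produce a windy steady weak
solution `u = c + U` (`c ∈ ℝ³` a momentum, `U ∈ V`): `u ∈ L² ∩ H¹`, weakly divergence free, solving
the steady tested equations against ALL smooth divergence-free fields, with `∫ |u|² ≤ E`, the energy
equation `ν ‖∇u‖² = (f, u)` and `ν ‖∇u‖² ≥ ε`.

The proof is Temam's existence proof (Temam 1979, Ch. II §1, Thm. 1.2, proof (ii)–(iii);
Constantin–Foias 1988, Ch. 8) run on the GIVEN Galerkin zeros, with the conserved momentum booked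
separately (the windy twin of `MirrorVarietyFixedViscosityTransfer`):

1. extract resolutions `N_n ↑ ∞` carrying such states `u_n` (`Filter.extraction_of_frequently_atTop`)
   and split `u_n = c_n + U_n`, `c_n = ∫ u_n`, `U_n ∈ 𝒱` band-limited to the punctured ball;
2. testing with `a = U_n` gives the windy Galerkin energy identity `ν ‖∇u_n‖² = ∫ ⟪f, u_n⟫`
   (`WindySteadyLimit.galerkin_energy_identity_windy`: the wind does no work, `∫ f = 0`), whence
   the uniform enstrophy bound `‖∇U_n‖² = ‖∇u_n‖² ≤ √E ‖f‖ / ν`; and `|c_n| ≤ 1 + E`;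
3. `(c_n, [U_n])` lie in the compact set `closedBall × {‖∇·‖² ≤ √E‖f‖/ν}` of `ℝ³ × H`
   (Heine–Borel × Rellich, `Torus.isCompact_setOf_eGradNormSq_le`), so a subsequence converges to
   `(c, U)` with `U ∈ V`; the full fields converge in `L²`;
4. the limit `u = c + U` solves the equations against mean-zero tests
   (`tendsto_integral_weakForm_of_tendsto_lintegral`, `tendsto_integral_weakForm_fourierTruncate`)
   and then against all smooth divergence-free tests (constants test trivially since `∫ f = 0`);
5. `∫ |u|² ≤ E` and `(f, u) = lim (f, u_n) = lim ν ‖∇u_n‖² ≥ ε` by strong `L²` convergence;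
6. the energy equation of the windy limit is `WindySteadyLimit.windy_energy_eq` (`d = 3 ≤ 4`).

References: R. Temam, *Navier–Stokes Equations* (1979), Ch. II §1 Thm. 1.2; P. Constantin, C. Foias,
*Navier–Stokes Equations* (1988), Ch. 8; J. C. Robinson, J. L. Rodrigo, W. Sadowski,
*The Three-Dimensional Navier–Stokes Equations* (2016), Thm. 4.4; G. P. Galdi, *An Introduction to the
Mathematical Theory of the Navier–Stokes Equations* (2011), Ch. IX.
-/

-- `Summit.<Summit>.<Problem>` is the tree's mandated summit-side namespace (CONVENTIONS §2); for this
-- single-conjunct summit the two coincide, so the duplicate is deliberate.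
set_option linter.dupNamespace false

noncomputable section

open MeasureTheory Filter Topology UnitAddTorus Set
open scoped InnerProductSpace RealInnerProductSpace ENNReal NNReal

namespace Summit.AnomalousDissipation.AnomalousDissipation.Theorems

open Literature.Analysis.FunctionSpaces Literature.Analysis.FunctionSpaces.Torus
open Literature.Analysis.FluidPDE.Torus

/-! ### The windy Galerkin energy identity -/

namespace WindySteadyLimit

variable {d : Type*} [Fintype d] [DecidableEq d]

/-- **Galerkin energy identity of a windy Galerkin zero** (Temam 1979, Ch. II §1, (1.29): take
`v = u_m` in the Galerkin equations — here `a = u - c` with the momentum `c` of `u`, the wind does no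
work). If `u` is smooth and divergence free, `f ∈ L²` has zero mean, and the tested steady equation
holds with the test field `a = u - c`,
`∫ (⟪u,(u·∇)(u - c)⟫ + ν ⟪u,Δ(u - c)⟫ + ⟪f,u - c⟫) = 0`, then `ν ‖∇u‖² = ∫ ⟪f, u⟫`
(`(u·∇)(u-c) = (u·∇)u`, `Δ(u-c) = Δu`, `∫ ⟪(u·∇)u, u⟫ = 0`, `∫ ⟪u, Δu⟫ = -‖∇u‖²`,
`∫ ⟪f, c⟫ = ⟪∫ f, c⟫ = 0`). [folklore] -/
theorem galerkin_energy_identity_windy {ν : ℝ} {f u : UnitAddTorus d → EuclideanSpace ℝ d}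
    (hf : MemLp f 2 volume) (hf0 : ∫ x, f x = 0) (hu : IsSmooth u) (hdiv : IsDivFree u)
    (c : EuclideanSpace ℝ d)
    (htest : ∫ x, (⟪u x, Torus.convect u (fun y => u y - c) x⟫_ℝ +
      ν * ⟪u x, Torus.laplacian (fun y => u y - c) x⟫_ℝ + ⟪f x, u x - c⟫_ℝ) = 0) :
    ν * gradNormSq u = ∫ x, ⟪f x, u x⟫_ℝ := by
  have hum : MemLp u 2 volume := hu.memLp 2
  have ha : IsSmooth (fun y => u y - c) := hu.sub (isSmooth_const c)
  have htest' : ∫ x, (⟪u x, Torus.convect u (fun y => u y - c) x⟫_ℝ +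
      ν * ⟪u x, Torus.laplacian (fun y => u y - c) x⟫_ℝ + ⟪f x, (fun y => u y - c) x⟫_ℝ) = 0 :=
    htest
  rw [integral_weakForm_eq ν hf hum ha] at htest'
  have hconv : ∫ x, ⟪Torus.fderiv (fun y => u y - c) x (u x), u x⟫_ℝ = 0 := by
    have h : ∀ x, Torus.fderiv (fun y => u y - c) x (u x) = Torus.convect u u x := fun x =>
      convect_sub_const hu c u x
    simp_rw [h]
    exact integral_inner_convect_self_eq_zero hu hdiv
  have hint : ∀ i, Integrable (fun x => ‖partialDeriv i u x‖ ^ 2) volume := fun i =>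
    ((hu.partialDeriv i).continuous.norm.pow 2).integrable_unitAddTorus
  have hlap : ∫ x, ⟪u x, Torus.laplacian (fun y => u y - c) x⟫_ℝ = -gradNormSq u := by
    simp_rw [laplacian_sub_const hu c]
    rw [integral_inner_laplacian_eq_neg_holds hu, gradNormSq,
      integral_finsetSum _ fun i _ => hint i]
  have hforce : ∫ x, ⟪f x, (fun y => u y - c) x⟫_ℝ = ∫ x, ⟪f x, u x⟫_ℝ := by
    simp_rw [inner_sub_right]
    rw [integral_sub (integrable_inner_of_continuous (hf.integrable one_le_two) hu.continuous)
        (integrable_inner_of_continuous (hf.integrable one_le_two) continuous_const),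
      integral_inner_const_right (hf.integrable one_le_two) c, hf0, inner_zero_left, sub_zero]
  rw [hconv, hlap, hforce, add_zero] at htest'
  linear_combination -htest'

end WindySteadyLimit

/-! ### The theorem -/

open WindySteadyLimit in
/-- Settles stmt-AnomalousDissipation-11421 (`WindLine.WindySteadyLimit`): at a fixed viscosity
`ν > 0`, windy Galerkin steady states (free momentum) at infinitely many resolutions with
`∫ |u_N|² ≤ E` and `ν ‖∇u_N‖² ≥ ε` yield a windy steady weak solution `u = c + U ∈ L² ∩ H¹`, weakly
divergence free, solving the steady tested Navier–Stokes equations against ALL smooth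
divergence-free fields, with `∫ |u|² ≤ E`, the energy equation `ν ‖∇u‖² = (f, u)` and
`ν ‖∇u‖² ≥ ε` — Temam's Galerkin existence proof (Temam 1979, Ch. II Thm. 1.2 (ii)–(iii);
Constantin–Foias 1988, Ch. 8) run on the given zeros with the momentum booked separately:
momenta `c_N = ∫ u_N` are bounded (`|c_N| ≤ 1 + E`), wakes `U_N = u_N - c_N ∈ 𝒱` have enstrophy
`≤ √E ‖f‖ / ν` by the windy Galerkin energy identity (test with `a = U_N`), a subsequence converges
in `ℝ³ × H` (Heine–Borel × Rellich), the limit solves the equations against mean-zero tests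
(`tendsto_integral_weakForm_of_tendsto_lintegral`, `tendsto_integral_weakForm_fourierTruncate`) and
then against all tests (`∫ f = 0`), and the energy equation is `WindySteadyLimit.windy_energy_eq`.
[cite: Temam1979, Ch. II Thm. 1.2] -/
theorem WindySteadyLimit_proof :
    Summit.AnomalousDissipation.AnomalousDissipation.Theses.WindLine.WindySteadyLimit := by
  intro ν E ε f hν hf hfdiv hfmean hfreq
  -- Step 0: a sequence of resolutions carrying loud bounded windy Galerkin states
  obtain ⟨Nseq, hNmono, hNP⟩ := Filter.extraction_of_frequently_atTop hfreq
  choose u hu using hNP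
  have hus : ∀ n, IsSmooth (u n) := fun n => (hu n).1.1
  have hudiv : ∀ n, IsDivFree (u n) := fun n => (hu n).1.2.1
  have huband : ∀ n, ∀ k ∉ freqBall (Nseq n),
      mFourierCoeff (EuclideanSpace.complexify ∘ u n) k = 0 := fun n => (hu n).1.2.2.1
  have hutest := fun n => (hu n).1.2.2.2
  have huE : ∀ n, ∫ x, ‖u n x‖ ^ 2 ≤ E := fun n => (hu n).2.1
  have huε : ∀ n, ε ≤ ν * gradNormSq (u n) := fun n => (hu n).2.2
  have hf2 : MemLp f 2 volume := hf.memLp 2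
  have hf0 : ∫ x, f x = 0 := hfmean
  have hum : ∀ n, MemLp (u n) 2 volume := fun n => (hus n).memLp 2
  have huint : ∀ n, Integrable (u n) volume := fun n => (hus n).integrable
  -- momenta and wakes `u_n = c_n + U_n`
  set c : ℕ → EuclideanSpace ℝ (Fin 3) := fun n => ∫ x, u n x with hc
  set U : ℕ → UnitAddTorus (Fin 3) → EuclideanSpace ℝ (Fin 3) := fun n x => u n x - c n with hU
  have hUs : ∀ n, IsSmooth (U n) := fun n => (hus n).sub (isSmooth_const _)
  have hUdiv : ∀ n, IsDivFree (U n) := fun n => isDivFree_sub_const (hus n) (hudiv n) (c n)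
  have hUmean : ∀ n, HasZeroMean (U n) := fun n => hasZeroMean_sub_integral (huint n)
  have hUm : ∀ n, MemLp (U n) 2 volume := fun n => (hUs n).memLp 2
  have hUband : ∀ n, ∀ k ∉ (freqBall (Nseq n)).erase (0 : Fin 3 → ℤ),
      mFourierCoeff (EuclideanSpace.complexify ∘ U n) k = 0 := by
    intro n k hk
    have hsub : (EuclideanSpace.complexify ∘ U n) =
        EuclideanSpace.complexify ∘ u n - (EuclideanSpace.complexify ∘ fun _ => c n) := by
      funext x; simp [hU]
    rw [hsub, mFourierCoeff_sub (integrable_complexify_comp (huint n))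
      (integrable_complexify_comp (integrable_const _)), mFourierCoeff_complexify_const]
    by_cases hk0 : k = 0
    · subst hk0
      rw [if_pos rfl, mFourierCoeff_complexify_zero, sub_self]
    · rw [if_neg hk0, sub_zero]
      exact huband n k fun hkN => hk (Finset.mem_erase.2 ⟨hk0, hkN⟩)
  -- Step 1: the windy Galerkin energy identity on the given zeros (test with `a = U_n`)
  have hEn : ∀ n, ν * gradNormSq (u n) = ∫ x, ⟪f x, u n x⟫_ℝ := fun n =>
    galerkin_energy_identity_windy hf2 hf0 (hus n) (hudiv n) (c n)
      (hutest n (U n) (hUs n) (hUdiv n) (hUband n))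
  -- Step 2: the wakes as elements of `H`; enstrophy and momentum bounds
  have hmem : ∀ n, (hUm n).toLp (U n) ∈ energySpace (Fin 3) := fun n =>
    smoothSolenoidal_subset_energySpace ⟨U n, hUs n, hUdiv n, hUmean n, (hUm n).coeFn_toLp⟩
  set v : ℕ → energySpace (Fin 3) := fun n => ⟨(hUm n).toLp (U n), hmem n⟩ with hv
  have hvae : ∀ n, ((v n).1 : UnitAddTorus (Fin 3) → EuclideanSpace ℝ (Fin 3)) =ᵐ[volume] U n :=
    fun n => (hUm n).coeFn_toLp
  have hgradU : ∀ n, eGradNormSq (U n) = eGradNormSq (u n) := fun n => by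
    have h : U n = fun x => -c n + u n x := by
      funext x; simp only [hU]; abel
    rw [h, eGradNormSq_const_add (-c n) (huint n)]
  have hinner : ∀ n, ⟪hf2.toLp f, (hum n).toLp (u n)⟫_ℝ = ∫ x, ⟪f x, u n x⟫_ℝ := fun n => by
    rw [MeasureTheory.L2.inner_def]
    refine integral_congr_ae ?_
    filter_upwards [hf2.coeFn_toLp, (hum n).coeFn_toLp] with x hx hy
    rw [hx, hy]
  have hnorm : ∀ n, ‖(hum n).toLp (u n)‖ ^ 2 = ∫ x, ‖u n x‖ ^ 2 := fun n => by
    rw [← integral_norm_sq_coe_eq]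
    refine integral_congr_ae ?_
    filter_upwards [(hum n).coeFn_toLp] with x hx
    rw [hx]
  have hnormE : ∀ n, ‖(hum n).toLp (u n)‖ ^ 2 ≤ E := fun n => (hnorm n).le.trans (huE n)
  have hCS : ∀ n, ∫ x, ⟪f x, u n x⟫_ℝ ≤ Real.sqrt E * ‖hf2.toLp f‖ := fun n => by
    rw [← hinner n]
    calc ⟪hf2.toLp f, (hum n).toLp (u n)⟫_ℝ ≤ ‖hf2.toLp f‖ * ‖(hum n).toLp (u n)‖ :=
          real_inner_le_norm _ _
      _ ≤ ‖hf2.toLp f‖ * Real.sqrt E :=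
          mul_le_mul_of_nonneg_left ((le_abs_self _).trans (Real.abs_le_sqrt (hnormE n)))
            (norm_nonneg _)
      _ = Real.sqrt E * ‖hf2.toLp f‖ := mul_comm _ _
  have hgradΛ : ∀ n, gradNormSq (u n) ≤ Real.sqrt E * ‖hf2.toLp f‖ / ν := fun n => by
    rw [le_div_iff₀ hν]
    calc gradNormSq (u n) * ν = ∫ x, ⟪f x, u n x⟫_ℝ := by rw [mul_comm, hEn n]
      _ ≤ Real.sqrt E * ‖hf2.toLp f‖ := hCS n
  have heGradΛ : ∀ n, eGradNormSq (U n) ≤ ENNReal.ofReal (Real.sqrt E * ‖hf2.toLp f‖ / ν) :=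
    fun n => by
    rw [hgradU n, eGradNormSq_eq_ofReal_gradNormSq (hus n)]
    exact ENNReal.ofReal_le_ofReal (hgradΛ n)
  have hcB : ∀ n, c n ∈ Metric.closedBall (0 : EuclideanSpace ℝ (Fin 3)) (1 + E) := fun n => by
    rw [Metric.mem_closedBall, dist_zero_right]
    have ig : Integrable (fun x => (1 : ℝ) + ‖u n x‖ ^ 2) volume :=
      (integrable_const _).add ((hum n).integrable_norm_pow two_ne_zero)
    calc ‖c n‖ = ‖∫ x, u n x‖ := rfl
      _ ≤ ∫ x, ‖u n x‖ := norm_integral_le_integral_norm _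
      _ ≤ ∫ x, ((1 : ℝ) + ‖u n x‖ ^ 2) :=
          integral_mono (huint n).norm ig fun x => by
            dsimp only
            nlinarith [sq_nonneg (‖u n x‖ - 1), norm_nonneg (u n x)]
      _ = 1 + ∫ x, ‖u n x‖ ^ 2 := by
          rw [integral_add (integrable_const _) ((hum n).integrable_norm_pow two_ne_zero),
            integral_const]
          simp
      _ ≤ 1 + E := by linarith [huE n]
  -- Step 3: compactness (Heine–Borel × Rellich) and the limit `u = c + U`
  set K : Set (energySpace (Fin 3)) :=
    {w | eGradNormSq (w.1 : UnitAddTorus (Fin 3) → EuclideanSpace ℝ (Fin 3)) ≤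
      ENNReal.ofReal (Real.sqrt E * ‖hf2.toLp f‖ / ν)} with hK
  have hKc : IsCompact K := isCompact_setOf_eGradNormSq_le ENNReal.ofReal_ne_top
  have hvK : ∀ n, v n ∈ K := fun n => by
    show eGradNormSq ((v n).1 : UnitAddTorus (Fin 3) → EuclideanSpace ℝ (Fin 3)) ≤
      ENNReal.ofReal (Real.sqrt E * ‖hf2.toLp f‖ / ν)
    rw [eGradNormSq_congr_ae_field (hvae n)]
    exact heGradΛ n
  have hPc : IsCompact (Metric.closedBall (0 : EuclideanSpace ℝ (Fin 3)) (1 + E) ×ˢ K) :=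
    (isCompact_closedBall _ _).prod hKc
  have hPmem : ∀ n, (c n, v n) ∈ Metric.closedBall (0 : EuclideanSpace ℝ (Fin 3)) (1 + E) ×ˢ K :=
    fun n => ⟨hcB n, hvK n⟩
  obtain ⟨q, hqK, φ, hφ, hlim⟩ := hPc.tendsto_subseq hPmem
  have hclim : Tendsto (fun j => c (φ j)) atTop (𝓝 q.1) := (continuous_fst.tendsto q).comp hlim
  have hvlim : Tendsto (fun j => v (φ j)) atTop (𝓝 q.2) := (continuous_snd.tendsto q).comp hlim
  set W : energySpace (Fin 3) := q.2 with hWdef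
  set Wf : UnitAddTorus (Fin 3) → EuclideanSpace ℝ (Fin 3) :=
    (W.1 : UnitAddTorus (Fin 3) → EuclideanSpace ℝ (Fin 3)) with hWf
  have hWL2 : MemLp Wf 2 volume := Lp.memLp _
  have hWint : Integrable Wf volume := hWL2.integrable one_le_two
  have hWG : eGradNormSq Wf ≤ ENNReal.ofReal (Real.sqrt E * ‖hf2.toLp f‖ / ν) := hqK.2
  have hWV : MemSobolev 1 (EuclideanSpace.complexify ∘ Wf) :=
    memSobolev_one_complexify_of_eGradNormSq_ne_top hWL2
      (ne_top_of_le_ne_top ENNReal.ofReal_ne_top hWG)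
  set uL : UnitAddTorus (Fin 3) → EuclideanSpace ℝ (Fin 3) := fun x => q.1 + Wf x with huL
  have huLm : MemLp uL 2 volume := (memLp_const q.1).add hWL2
  -- the full fields in `L²` and their convergence along the subsequence
  have hut_eq : ∀ n, (hum n).toLp (u n) =
      Lp.const 2 (volume : Measure (UnitAddTorus (Fin 3))) (c n) + (v n).1 := fun n => by
    rw [← MemLp.toLp_const, hv]
    dsimp only
    rw [← MemLp.toLp_add]
    exact MemLp.toLp_congr _ _ (Eventually.of_forall fun x => by simp [hU])
  set uLt : Lp (EuclideanSpace ℝ (Fin 3)) 2 (volume : Measure (UnitAddTorus (Fin 3))) :=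
    Lp.const 2 (volume : Measure (UnitAddTorus (Fin 3))) q.1 + W.1 with huLt
  have h1 : Tendsto (fun j => (hum (φ j)).toLp (u (φ j))) atTop (𝓝 uLt) := by
    have hcst : Tendsto (fun j => Lp.const 2 (volume : Measure (UnitAddTorus (Fin 3))) (c (φ j)))
        atTop (𝓝 (Lp.const 2 (volume : Measure (UnitAddTorus (Fin 3))) q.1)) := by
      have h := ((Lp.constL 2 (volume : Measure (UnitAddTorus (Fin 3))) ℝ).continuous.tendsto
        q.1).comp hclim
      rw [Lp.constL_apply] at h
      exact h.congr fun j => by simp only [Function.comp_apply, Lp.constL_apply]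
    have hsnd : Tendsto (fun j => (v (φ j)).1) atTop (𝓝 W.1) :=
      (continuous_subtype_val.tendsto W).comp hvlim
    simp_rw [hut_eq]
    exact hcst.add hsnd
  have huLae : (uLt : UnitAddTorus (Fin 3) → EuclideanSpace ℝ (Fin 3)) =ᵐ[volume] uL := by
    filter_upwards [Lp.coeFn_add (Lp.const 2 (volume : Measure (UnitAddTorus (Fin 3))) q.1) W.1,
      Lp.coeFn_const 2 (volume : Measure (UnitAddTorus (Fin 3))) q.1] with x hx hcx
    rw [hx, Pi.add_apply, hcx]
    rfl
  have hutae : ∀ n, ((hum n).toLp (u n) : UnitAddTorus (Fin 3) → EuclideanSpace ℝ (Fin 3))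
      =ᵐ[volume] u n := fun n => (hum n).coeFn_toLp
  have hconv : Tendsto (fun j => ∫⁻ x, ‖u (φ j) x - uL x‖ₑ ^ 2) atTop (𝓝 0) := by
    have h2 := tendsto_iff_norm_sub_tendsto_zero.1 h1
    have h3 : Tendsto (fun j => ‖(hum (φ j)).toLp (u (φ j)) - uLt‖ₑ ^ 2) atTop (𝓝 0) := by
      have h4 := ENNReal.tendsto_ofReal h2
      rw [ENNReal.ofReal_zero] at h4
      have h5 := ((ENNReal.continuous_pow 2).tendsto 0).comp h4
      rw [zero_pow two_ne_zero] at h5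
      refine h5.congr fun j => ?_
      simp only [Function.comp_apply, ofReal_norm]
    refine h3.congr fun j => ?_
    rw [← lintegral_enorm_coe_sub_coe_sq]
    refine lintegral_congr_ae ?_
    filter_upwards [hutae (φ j), huLae] with x hx hy
    rw [hx, hy]
  have hUB : ∀ n, ∫⁻ x, ‖u n x‖ₑ ^ 2 ≤ ENNReal.ofReal E := fun n => by
    rw [lintegral_enorm_sq_eq_ofReal (hum n)]
    exact ENNReal.ofReal_le_ofReal (huE n)
  -- Step 4: the limit solves the steady tested equations against mean-zero test fields ...
  have hweak0 : ∀ w : UnitAddTorus (Fin 3) → EuclideanSpace ℝ (Fin 3), IsSmooth w → IsDivFree w →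
      HasZeroMean w → ∫ x, (⟪uL x, Torus.convect uL w x⟫_ℝ + ν * ⟪uL x, Torus.laplacian w x⟫_ℝ +
        ⟪f x, w x⟫_ℝ) = 0 := by
    intro w hw hwdiv hwmean
    have htrunc : ∀ M : ℕ, ∫ x, (⟪uL x, Torus.convect uL (fourierTruncate M w) x⟫_ℝ +
        ν * ⟪uL x, Torus.laplacian (fourierTruncate M w) x⟫_ℝ + ⟪f x, fourierTruncate M w x⟫_ℝ) = 0 := by
      intro M
      have ha : IsSmooth (fourierTruncate M w) := isSmooth_fourierTruncate M w
      have hadiv : IsDivFree (fourierTruncate M w) :=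
        isDivFree_realTrigPoly (hwdiv.isTransversal_mFourierCoeff hw (freqBall M))
      have hw0 : mFourierCoeff (EuclideanSpace.complexify ∘ w) 0 = 0 := by
        rw [mFourierCoeff_complexify_zero, hwmean, map_zero]
      have hband : ∀ N, M ≤ N → ∀ k ∉ (freqBall (d := Fin 3) N).erase 0,
          mFourierCoeff (EuclideanSpace.complexify ∘ fourierTruncate M w) k = 0 := by
        intro N hMN k hk
        rw [mFourierCoeff_fourierTruncate hw.integrable]
        by_cases hkM : k ∈ freqBall M
        · have hk0 : k = 0 := by
            by_contra h
            exact hk (Finset.mem_erase.2 ⟨h, freqBall_mono hMN hkM⟩)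
          subst hk0
          rw [if_pos hkM, hw0]
        · rw [if_neg hkM]
      have hev : ∀ᶠ j in atTop,
          ∫ x, (⟪u (φ j) x, Torus.convect (u (φ j)) (fourierTruncate M w) x⟫_ℝ +
            ν * ⟪u (φ j) x, Torus.laplacian (fourierTruncate M w) x⟫_ℝ +
            ⟪f x, fourierTruncate M w x⟫_ℝ) = 0 := by
        filter_upwards [eventually_ge_atTop M] with j hj
        exact hutest (φ j) _ ha hadiv
          (hband (Nseq (φ j)) ((hj.trans (hφ.id_le j)).trans (hNmono.id_le _)))
      have hl := tendsto_integral_weakForm_of_tendsto_lintegral (ν := ν) hf2 (fun n => hum (φ n))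
        huLm ENNReal.ofReal_ne_top (fun n => hUB (φ n)) hconv ha
      exact tendsto_nhds_unique hl (tendsto_const_nhds.congr' (hev.mono fun j hj => hj.symm))
    have hl2 := tendsto_integral_weakForm_fourierTruncate ν hf2 huLm hw
    exact tendsto_nhds_unique hl2 (tendsto_const_nhds.congr fun M => (htrunc M).symm)
  -- ... and against all smooth divergence-free test fields (`∫ f = 0`)
  have hweak : ∀ w : UnitAddTorus (Fin 3) → EuclideanSpace ℝ (Fin 3), IsSmooth w → IsDivFree w →
      ∫ x, (⟪uL x, Torus.convect uL w x⟫_ℝ + ν * ⟪uL x, Torus.laplacian w x⟫_ℝ + ⟪f x, w x⟫_ℝ) = 0 := by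
    intro w hw hwdiv
    have h0 := hweak0 (fun y => w y - ∫ x, w x) (hw.sub (isSmooth_const _))
      (isDivFree_sub_const hw hwdiv _) (hasZeroMean_sub_integral hw.integrable)
    have hpt : ∀ x, ⟪uL x, Torus.convect uL (fun y => w y - ∫ z, w z) x⟫_ℝ +
        ν * ⟪uL x, Torus.laplacian (fun y => w y - ∫ z, w z) x⟫_ℝ +
        ⟪f x, (fun y => w y - ∫ z, w z) x⟫_ℝ =
        (⟪uL x, Torus.convect uL w x⟫_ℝ + ν * ⟪uL x, Torus.laplacian w x⟫_ℝ + ⟪f x, w x⟫_ℝ) -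
          ⟪f x, ∫ z, w z⟫_ℝ := by
      intro x
      rw [convect_sub_const hw _ uL x, laplacian_sub_const hw _ x]
      dsimp only
      rw [inner_sub_right]
      ring
    simp_rw [hpt] at h0
    have hint : Integrable (fun x => ⟪uL x, Torus.convect uL w x⟫_ℝ +
        ν * ⟪uL x, Torus.laplacian w x⟫_ℝ + ⟪f x, w x⟫_ℝ) volume :=
      ((integrable_inner_convect_of_memLp huLm hw).add ((integrable_inner_of_continuous
        (huLm.integrable one_le_two) hw.laplacian.continuous).const_mul ν)).add
        (integrable_inner_of_continuous (hf2.integrable one_le_two) hw.continuous)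
    rw [integral_sub hint (integrable_inner_of_continuous (hf2.integrable one_le_two)
        continuous_const), integral_inner_const_right (hf2.integrable one_le_two), hf0,
      inner_zero_left, sub_zero] at h0
    exact h0
  -- Step 5: the energy bound passes to the limit
  have hnorm_lim : Tendsto (fun j => ‖(hum (φ j)).toLp (u (φ j))‖ ^ 2) atTop (𝓝 (‖uLt‖ ^ 2)) :=
    h1.norm.pow 2
  have huLE : ∫ x, ‖uL x‖ ^ 2 ≤ E := by
    have h : ∫ x, ‖uL x‖ ^ 2 = ‖uLt‖ ^ 2 := by
      rw [← integral_norm_sq_coe_eq]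
      refine integral_congr_ae ?_
      filter_upwards [huLae] with x hx
      rw [hx]
    rw [h]
    exact le_of_tendsto' hnorm_lim fun j => hnormE (φ j)
  -- Step 6: the energy equation of the windy limit (`d = 3`)
  have heq : ν * (eGradNormSq uL).toReal = ∫ x, ⟪f x, uL x⟫_ℝ :=
    windy_energy_eq (d := Fin 3) (by simp) (by simp) hf2 hf0 q.1 W hWV hweak0
  -- Step 7: `(f, u) = lim (f, u_n) = lim ν ‖∇u_n‖² ≥ ε`
  have hpair_lim : Tendsto (fun j => ∫ x, ⟪f x, u (φ j) x⟫_ℝ) atTop (𝓝 (∫ x, ⟪f x, uL x⟫_ℝ)) := by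
    have h := Filter.Tendsto.inner (𝕜 := ℝ) (tendsto_const_nhds (x := hf2.toLp f)) h1
    have e2 : ⟪hf2.toLp f, uLt⟫_ℝ = ∫ x, ⟪f x, uL x⟫_ℝ := by
      rw [MeasureTheory.L2.inner_def]
      refine integral_congr_ae ?_
      filter_upwards [hf2.coeFn_toLp, huLae] with x hx hy
      rw [hx, hy]
    rw [← e2]
    exact h.congr fun j => hinner (φ j)
  have hεpair : ∀ j, ε ≤ ∫ x, ⟪f x, u (φ j) x⟫_ℝ := fun j => by
    rw [← hEn]
    exact huε (φ j)
  have huε' : ε ≤ ∫ x, ⟪f x, uL x⟫_ℝ := ge_of_tendsto' hpair_lim hεpair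
  -- assembly
  refine ⟨uL, huLm, ?_, ?_, hweak, huLE, heq, heq ▸ huε'⟩
  · -- `u ∈ H¹`
    refine memSobolev_one_complexify_of_eGradNormSq_ne_top huLm ?_
    rw [huL, eGradNormSq_const_add q.1 hWint]
    exact ne_top_of_le_ne_top ENNReal.ofReal_ne_top hWG
  · -- `u` is weakly divergence free
    intro θ hθ
    have hWdf : IsWeaklyDivFree Wf := isWeaklyDivFree_of_mem_energySpace W.2
    simp only [huL, inner_add_left]
    rw [integral_add (integrable_inner_of_continuous (integrable_const q.1) hθ.gradient.continuous)
      (integrable_inner_of_continuous hWint hθ.gradient.continuous), hWdf θ hθ, add_zero]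
    have h : ∀ x, ⟪q.1, Torus.gradient θ x⟫_ℝ = Torus.lineDeriv θ x q.1 := fun x =>
      calc ⟪q.1, Torus.gradient θ x⟫_ℝ = ⟪Torus.gradient θ x, q.1⟫_ℝ := real_inner_comm _ _
        _ = Torus.fderiv θ x q.1 := Torus.inner_gradient_left θ x q.1
        _ = Torus.lineDeriv θ x q.1 := (lineDeriv_eq_fderiv_apply (hθ.isContDiff (by simp)) x q.1).symm
    simp_rw [h]
    exact integral_lineDeriv_eq_zero hθ q.1

end Summit.AnomalousDissipation.AnomalousDissipation.Theorems

end
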